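import Summits.Ventures.PercRepro.RankLevelSetLevelSix
import Summits.Ventures.PercRepro.RankLevelSetLevelFiveAll

/-!
# PercRepro — THEOREM C₆, UNCONDITIONAL: C-025 at level `6` for every finite matroid and every `p ≥ 124426`
(night-1, gen 4)

`proofs/NIGHT-1-C025-induction.md` §15.9. `c025_six_of_five` (RankLevelSetLevelSix) composed with THEOREM C₅
`c025_five_large` (RankLevelSetLevelFiveAll). Axioms: standard.
-/

open scoped Matroid

namespace PercRepro

namespace ThmN

variable {α : Type}

/-- **THEOREM C₆**: every finite matroid satisfies C-025 at level `6` for every `p ≥ 124426`. -/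
theorem c025_six_large (M : Matroid α) [M.Finite] (p : ℕ) (hp : 124426 ≤ p) : RLS M p 6 :=
  c025_six_of_five (fun M _ p hp => c025_five_large M p hp) M p hp

/-- The level-`6` statement in the vocabulary of `C025`. -/
theorem c025_six_large' (M : Matroid α) [M.Finite] (p : ℕ) (hp : 124426 ≤ p) :
    phiK p 6 * ({A : Set α | A ⊆ M.E ∧ M.eRk A = (p : ℕ∞) ∧ M.eRk (M.E \ A) = (6 : ℕ∞)}.ncard : ℚ) ≤
      ({A : Set α | A ⊆ M.E ∧ (6 : ℕ∞) < M.eRk A ∧ M.eRk A < (p : ℕ∞)}.ncard : ℚ) :=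
  c025_six_large M p hp

end ThmN

end PercRepro
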